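import Summits.NavierStokesRegularity.NavierStokesRegularity.Theses.CertifiedBlowup
import Literature.Analysis.FluidPDE.GeneralizedAxisymNS

/-!
# `CertifiedBlowupAxisymBlowup` (stmt-NavierStokesRegularity-0727) — line `houli-cap-format`

Crux (shared by routes CertifiedBlowup #2, DimensionLadder #4, SwirlThreshold #4):
`∃ ν > 0, ∃ T > 0, ∃ u p, IsMaximalSmoothSolution ν 0 u p T ∧ IsLerayHopfOn T ν 0 (u 0) u ∧
HasRapidSpatialDecay (u 0) ∧ IsAxisymmetric (u 0)` — finite-time blow-up of axisymmetric
Navier–Stokes from a Clay datum.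

Strategist line (crux protocol (a)): REDUCTION TO THE CONSTRUCTION FORMAT.  Every construction
technology that exists for this crux — dynamic-rescaling computer-assisted proof (Chen–Hou,
arXiv:2210.07191 / 2305.05660), Hou's interior tornado computations (arXiv:2107.06509,
arXiv:2405.10916), the prior programme's CAP attempts — works in the Hou–Li meridian variables
`u₁ = u^θ/r`, `ω₁ = ω^θ/r`, `ψ₁ = ψ^θ/r` on the half-plane, where the `1/r` singular terms are
absorbed into the 5-D-type operator `∂_rr + (3/r)∂_r + ∂_zz` (tree:
`Literature.Analysis.FluidPDE.GeneralizedAxisymNS` at `n = 3`), and delivers ONE scalar blow-up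
diagnostic, `‖u₁(t)‖_{L∞} → ∞` near the axis, for a classical solution with decaying datum,
non-increasing energy and full regularity before `T`.  It never delivers the Clay bookkeeping
(pressure on `ℝ³`, Leray–Hopf structure on the CLOSED interval `[0, T]`, `IsMaximalSmoothSolution`
against ALL smooth extensions).  This skeleton makes the crux close MECHANICALLY from such an output:

1. `stub_houLiSwirlBlowup` (hardest; the open construction, in producer format) — a classical
   solution of the Hou–Li system at `n = 3` on `[0,T)`, rapidly decaying reconstructed datum,
   bounded energy, locally-in-time bounded velocity/gradient/enstrophy, and `u₁` unbounded on a
   bounded off-axis meridian region as `t ↑ T`.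
2. `stub_houLiToNS` (L) — Hou–Li ⇒ axisymmetric Navier–Stokes on `ℝ³ × [0,T)`: smoothness across
   the axis from evenness (Liu–Wang parity), the poloidal momentum equations recovered from the
   `ω₁`-equation up to a gradient, the pressure as a primitive of a closed smooth 1-form.
3. `stub_swirlBlowup_notExtend` (M) — `u₁ = Γ/r²` off the axis; a smooth extension past `T` would be
   axisymmetric up to `T` with `Γ = O(r²)` uniformly on compacts (Taylor at the axis), so `u₁` would
   stay bounded: contradiction.  Hence `¬ HasSmoothExtensionPast`.
4. `stub_clayWitness_of_classicalBlowup` (L; symmetry-free, reusable by every negative route) — a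
   classical solution on `[0,T)` from a rapidly decaying datum with bounded energy and local-in-time
   `L^∞ ∩ Ḣ¹` bounds that does not extend is, after redefining `u T :=` weak-`L²` limit, a MAXIMAL
   smooth solution which is Leray–Hopf on `[0,T]` (pressure-free weak form; Serrin-class
   weak–strong uniqueness against Leray's solution gives the energy inequalities; weak continuity
   at `T` from the uniform `L²` bound).

Glue `CertifiedBlowupAxisymBlowup_of` (sorry-free): 1 ⇒ (ν,T,u₁,ω₁,ψ₁); 2 ⇒ pressure and the
classical NS solution `u t = toVelocity (u₁ t) (ψ₁ t)`; 3 ⇒ no extension; 4 ⇒ (u',p') maximal and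
Leray–Hopf agreeing with `u` on `[0,T)`; `u' 0 = u 0` carries decay and axisymmetry
(`isAxisymmetric_toVelocity`, proved here).
-/

noncomputable section

-- the summit and its single problem share the name `NavierStokesRegularity` (D-0017 nested layout)
set_option linter.dupNamespace false

open Set Function Filter Topology MeasureTheory WithLp
open scoped ENNReal NNReal ContDiff

namespace Summit.NavierStokesRegularity.NavierStokesRegularity.Cruxes.CertifiedBlowupAxisymBlowup.HouLiCapFormat

open Literature.Analysis.FluidPDE

/-- `ℝ³`. -/
local notation "ℝ³" => EuclideanSpace ℝ (Fin 3)

/-! ## Stubs -/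

/-- STUB 1 (hardest — the construction, in Hou–Li / dynamic-rescaling OUTPUT FORMAT).
There are `ν > 0`, `T > 0` and a classical solution `(u₁, ω₁, ψ₁)` of the Hou–Li system
(`GeneralizedAxisymNS` at `n = 3`) on `[0, T)` such that: the reconstructed datum
`toVelocity (u₁ 0) (ψ₁ 0)` is rapidly decaying (Fefferman (4)); the reconstructed velocity has
bounded energy on `[0, T)`; on every `[0, T']`, `T' < T`, velocity and velocity gradient are
bounded and the enstrophy is bounded (full regularity before the singular time — what every
construction delivers); and the Hou–Li swirl variable `u₁ = u^θ/r` is unbounded on a bounded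
OFF-AXIS meridian region as `t ↑ T` (Hou's diagnostic `‖u₁‖_∞ → ∞`, arXiv:2107.06509 §3.4;
axis values of `u₁` are invisible in the velocity, hence `0 < q.1`). -/
theorem stub_houLiSwirlBlowup :
    ∃ ν : ℝ, 0 < ν ∧ ∃ T : ℝ, 0 < T ∧ ∃ u₁ ω₁ ψ₁ : ℝ → ℝ × ℝ → ℝ,
      GeneralizedAxisymNS.IsClassicalSolutionOn (Ico 0 T) 3 ν u₁ ω₁ ψ₁ ∧
      HasRapidSpatialDecay (GeneralizedAxisymNS.toVelocity (u₁ 0) (ψ₁ 0)) ∧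
      (∃ E : ℝ≥0, ∀ t ∈ Ico 0 T, eEnergy (GeneralizedAxisymNS.toVelocity (u₁ t) (ψ₁ t)) ≤ E) ∧
      (∀ T' : ℝ, 0 < T' → T' < T → ∃ B : ℝ, ∀ t ∈ Icc 0 T',
        (∀ x : ℝ³, ‖GeneralizedAxisymNS.toVelocity (u₁ t) (ψ₁ t) x‖ ≤ B ∧
          ‖fderiv ℝ (GeneralizedAxisymNS.toVelocity (u₁ t) (ψ₁ t)) x‖ ≤ B) ∧
        ∫⁻ x : ℝ³, ‖fderiv ℝ (GeneralizedAxisymNS.toVelocity (u₁ t) (ψ₁ t)) x‖ₑ ^ 2 ≤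
          ENNReal.ofReal B) ∧
      (∃ R : ℝ, ∀ M : ℝ, ∃ t ∈ Ico 0 T, ∃ q : ℝ × ℝ, 0 < q.1 ∧ ‖q‖ ≤ R ∧ M < |u₁ t q|) := by
  sorry

/-- STUB 2 (Hou–Li ⇒ Navier–Stokes at `n = 3`, the `m = 1` dictionary).  A classical solution
of the Hou–Li system at `n = 3` on `[0,T)` reconstructs, via
`u t = toVelocity (u₁ t) (ψ₁ t) = u^r e_r + r u₁ e_θ + u^z e_z`, to a classical solution of
unforced Navier–Stokes on `ℝ³ × [0,T)` for SOME smooth pressure (Hou–Li 2008 / Hou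
arXiv:2405.10916 p. 7: at `n = 3` the system is the axisymmetric NS equations; smoothness across
the axis from evenness in `r` — Liu–Wang 2006; the poloidal momentum equations from the
`ω₁`-equation and incompressibility up to a gradient, which defines `∇p`; `p` is a primitive of a
smooth closed 1-form on `ℝ³`, jointly smooth in `(t,x)`). -/
theorem stub_houLiToNS (ν T : ℝ) (u₁ ω₁ ψ₁ : ℝ → ℝ × ℝ → ℝ) (hν : 0 < ν) (hT : 0 < T)
    (h : GeneralizedAxisymNS.IsClassicalSolutionOn (Ico 0 T) 3 ν u₁ ω₁ ψ₁) :
    ∃ p : ℝ → ℝ³ → ℝ, IsClassicalNSSolutionOn (Ico 0 T) ν 0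
      (fun t => GeneralizedAxisymNS.toVelocity (u₁ t) (ψ₁ t)) p := by
  sorry

/-- STUB 3 (blow-up of `u₁` off the axis forbids a smooth extension).  If the reconstructed
field is a classical NS solution on `[0,T)` and `u₁` is unbounded on a bounded off-axis meridian
region as `t ↑ T`, then it admits no classical extension past `T`: off the axis
`u₁ (t, meridian x) = swirl (u t) x / r²` (`swirl_toVelocity`); an extension `u'` on `[0,T')`,
`T' > T`, is jointly smooth on `[0,T] × B̄_R`, equals `u t` (axisymmetric,
`isAxisymmetric_toVelocity`) for `t < T`, so its swirl and the horizontal gradient of its swirl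
vanish on the axis and `|swirl (u' t) x| ≤ ½ r² sup ‖D²‖` uniformly — `u₁` bounded, absurd. -/
theorem stub_swirlBlowup_notExtend (ν T : ℝ) (u₁ ψ₁ : ℝ → ℝ × ℝ → ℝ) (p : ℝ → ℝ³ → ℝ)
    (hT : 0 < T)
    (h : IsClassicalNSSolutionOn (Ico 0 T) ν 0
      (fun t => GeneralizedAxisymNS.toVelocity (u₁ t) (ψ₁ t)) p)
    (hblow : ∃ R : ℝ, ∀ M : ℝ, ∃ t ∈ Ico 0 T, ∃ q : ℝ × ℝ, 0 < q.1 ∧ ‖q‖ ≤ R ∧ M < |u₁ t q|) :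
    ¬ HasSmoothExtensionPast ν 0 (fun t => GeneralizedAxisymNS.toVelocity (u₁ t) (ψ₁ t)) T := by
  sorry

/-- STUB 4 (a tame classical blow-up from a Clay datum IS a Clay-side witness; no symmetry
used).  Let `(u, p)` be a classical solution of unforced NS (`ν > 0`) on `[0,T)` from a rapidly
decaying datum, with bounded energy on `[0,T)`, and on every `[0,T']`, `T' < T`, bounded velocity,
bounded velocity gradient and bounded enstrophy, admitting no smooth extension past `T`.  Then,
redefining the velocity at times `t ≥ T` only (`u T :=` the weak-`L²` limit of `u t`, `t ↑ T`,
which exists by the uniform `L²` bound and the weak formulation), one gets `(u', p')` agreeing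
with `u` on `[0,T)` which is a MAXIMAL smooth solution with lifespan `T` and Leray–Hopf on
`[0,T]` with datum `u 0` (classical ⇒ pressure-free weak solution; on each `[0,T']` it lies in
`L^∞_t L² ∩ L²_t Ḣ¹ ∩ L^∞_{t,x}`, so Serrin weak–strong uniqueness identifies it with Leray's
weak solution and yields the energy inequalities; weak continuity into `L²` up to `T` and the
strong initial limit follow) (Leray 1934 §III; Serrin 1963; Galdi 2000 Thm 4.2;
Robinson–Rodrigo–Sadowski 2016 Thms 4.6, 8.19). -/
theorem stub_clayWitness_of_classicalBlowup (ν T : ℝ) (u : ℝ → ℝ³ → ℝ³) (p : ℝ → ℝ³ → ℝ)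
    (hν : 0 < ν) (hT : 0 < T) (h : IsClassicalNSSolutionOn (Ico 0 T) ν 0 u p)
    (hdec : HasRapidSpatialDecay (u 0))
    (hE : ∃ E : ℝ≥0, ∀ t ∈ Ico 0 T, eEnergy (u t) ≤ E)
    (hB : ∀ T' : ℝ, 0 < T' → T' < T → ∃ B : ℝ, ∀ t ∈ Icc 0 T',
      (∀ x : ℝ³, ‖u t x‖ ≤ B ∧ ‖fderiv ℝ (u t) x‖ ≤ B) ∧
        ∫⁻ x : ℝ³, ‖fderiv ℝ (u t) x‖ₑ ^ 2 ≤ ENNReal.ofReal B)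
    (hmax : ¬ HasSmoothExtensionPast ν 0 u T) :
    ∃ (u' : ℝ → ℝ³ → ℝ³) (p' : ℝ → ℝ³ → ℝ), (∀ t ∈ Ico 0 T, u' t = u t) ∧
      IsMaximalSmoothSolution ν 0 u' p' T ∧ IsLerayHopfOn T ν 0 (u 0) u' := by
  sorry

/-! ## Glue -/

/-- The radial frame vector is rotation-equivariant (folklore; cf. `eR_rotZ` elsewhere in tree). -/
theorem eR_rotZ' (θ : ℝ) (x : ℝ³) : eR (rotZ θ x) = rotZ θ (eR x) := by
  ext i
  fin_cases i <;> simp [eR, cylRadius_rotZ] <;> ring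

/-- The angular frame vector is rotation-equivariant (folklore; cf. `eTheta_rotZ`). -/
theorem eTheta_rotZ' (θ : ℝ) (x : ℝ³) : eTheta (rotZ θ x) = rotZ θ (eTheta x) := by
  rw [eTheta, eTheta, cylRadius_rotZ]
  ext i
  fin_cases i <;> simp [rotZ] <;> ring

/-- The axial frame vector is rotation-invariant (folklore; cf. `rotZ_eZ`). -/
theorem rotZ_eZ'' (θ : ℝ) : rotZ θ (eZ : ℝ³) = eZ := by
  ext i
  fin_cases i <;> simp [rotZ, eZ]

/-- Rotations about the axis are linear: scalar multiples. -/
theorem rotZ_smul'' (θ c : ℝ) (y : ℝ³) : rotZ θ (c • y) = c • rotZ θ y := by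
  ext i
  fin_cases i <;> simp [rotZ] <;> ring

/-- Rotations about the axis are linear: sums. -/
theorem rotZ_add_vec (θ : ℝ) (y y' : ℝ³) : rotZ θ (y + y') = rotZ θ y + rotZ θ y' := by
  ext i
  fin_cases i <;> simp [rotZ] <;> ring

/-- The meridian coordinates are rotation-invariant. -/
theorem meridian_rotZ (θ : ℝ) (x : ℝ³) : meridian (rotZ θ x) = meridian x := by
  simp [meridian_apply, cylRadius_rotZ]

/-- **Reconstructed Hou–Li fields are axisymmetric**: `toVelocity a b (R_θ x) = R_θ (toVelocity a b x)`
(the cylindrical components depend on `(r, z)` only and the frame rotates). -/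
theorem isAxisymmetric_toVelocity (a b : ℝ × ℝ → ℝ) :
    IsAxisymmetric (GeneralizedAxisymNS.toVelocity a b) := by
  intro θ x
  simp only [GeneralizedAxisymNS.toVelocity, meridian_rotZ, eR_rotZ', eTheta_rotZ', rotZ_add_vec,
    rotZ_smul'', rotZ_eZ'']

/-! ## The crux from the stubs -/

/-- **`CertifiedBlowupAxisymBlowup` (stmt-NavierStokesRegularity-0727) from the four stubs.** -/
theorem CertifiedBlowupAxisymBlowup_of :
    Summit.NavierStokesRegularity.NavierStokesRegularity.Theses.CertifiedBlowup.CertifiedBlowupAxisymBlowup := by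
  obtain ⟨ν, hν, T, hT, u₁, ω₁, ψ₁, hcl, hdec, hE, hB, hblow⟩ := stub_houLiSwirlBlowup
  obtain ⟨p, hns⟩ := stub_houLiToNS ν T u₁ ω₁ ψ₁ hν hT hcl
  have hnext : ¬ HasSmoothExtensionPast ν 0
      (fun t => GeneralizedAxisymNS.toVelocity (u₁ t) (ψ₁ t)) T :=
    stub_swirlBlowup_notExtend ν T u₁ ψ₁ p hT hns hblow
  obtain ⟨u', p', hagree, hmax, hLH⟩ :=
    stub_clayWitness_of_classicalBlowup ν T (fun t => GeneralizedAxisymNS.toVelocity (u₁ t) (ψ₁ t))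
      p hν hT hns hdec hE hB hnext
  have h0 : (0 : ℝ) ∈ Ico 0 T := ⟨le_rfl, hT⟩
  have hu0 : u' 0 = GeneralizedAxisymNS.toVelocity (u₁ 0) (ψ₁ 0) := hagree 0 h0
  refine ⟨ν, hν, T, hT, u', p', hmax, ?_, ?_, ?_⟩
  · rw [hu0]; exact hLH
  · rw [hu0]; exact hdec
  · rw [hu0]; exact isAxisymmetric_toVelocity (u₁ 0) (ψ₁ 0)

end Summit.NavierStokesRegularity.NavierStokesRegularity.Cruxes.CertifiedBlowupAxisymBlowup.HouLiCapFormat
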